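import Summits.KontsevichZagierPeriods.Zeta5Search.Brown8.XStarOrbitCover
import Summits.KontsevichZagierPeriods.Zeta5Search.Certificates.BinomialSumBounds

/-!
# Brown8 / LeadingCoefficient — BZ's leading coefficient `Q(a)` (17) vanishes EXACTLY off the live cone; a non-live specimen (fam-brown8 gen 11)

systematic search; no irrationality claim unless certified.  Nothing here concerns irrationality measures or ζ(5)
records; these are combinatorial identities about Brown–Zudilin's 8-parameter cellular family [BrownZudilin2022]
and corollaries CONDITIONAL on the named Literature fact `decomposition` ((4) with (17)).

MAIN THEOREM (`liveBZ_iff_QOf_ne_zero`).  For every convergent integer exponent vector `a` (the seventeen forms (3)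
`≥ 0`):  `LiveBZ a ↔ QOf a ≠ 0`.  Here `LiveBZ` is the gen-3 "live cone" of this programme (all twenty two-valued
`σ_F`-valuations `≤ -1`, `Families/CellularEightMiddleWeights.lean`) and `QOf a = Q(p(a); q(a))` is BZ's explicit
double binomial sum (17), the coefficient of `2ζ(5)+4ζ(3)ζ(2)` in the decomposition (4).
* `QOf_eq_zero_of_not_liveBZ`: off the live cone EVERY term of (17) has a vanishing binomial factor (after unfolding,
  `split_ifs` + `omega` on each of the `2⁷` sign patterns of the seven factors);
* `QOf_ne_zero_of_liveBZ`: on the live cone all terms are `≥ 0` and the term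
  `k₁ = min(p₁+q₁, p₂+q₂)`, `k₂ = min(p₄+q₄, p₅+q₅)` (BZ's indexing `p₀,…,p₆`, `q₁,…,q₅`; in the tree `q_{j+1} = qOf a j`)
  has all seven factors positive (and no other corner of the summation box works uniformly).
So the live cone is intrinsic to [BrownZudilin2022]: it is precisely where the leading coefficient of (4) is non-zero.

COROLLARY (`mem_QZeta2_of_not_liveBZ`, conditional on `decomposition`): off the live cone
`I(a) = -4P̂ζ(2) - 2P ∈ ℚζ(2) + ℚ` — no `ζ(5)` and no `ζ(3)`.  Together with `liveBZ_zeta3Free_of`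
(`Brown8/XStarOrbitCover.lean`) this describes the whole convergent cone.

SPECIMEN (`specimenC = (2,0,4,0,2,1,1,4)`): convergent, not live, not in the `X*`-region, `Q = 0` (kernel, `decide`).
ENGINE FACTS about it (fam-brown8 g11 `pub-zeta5-fam-brown8/g11/README.md` §C; NOT kernel-checked, documentation only):
its polar set `A(c)` (42 boundary divisors of `M̄_{0,8}`) has weight profile `(h₀,…,h₅) = (1,0,1,4,0,0)`
(`h_m = dim gr^W_{2m} H⁵(M̄_{0,8}∖A(c), δ∖A(c))`); its weight-6 classes SURVIVE in `U₈` (restriction rank `1`, exact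
rational dual certificate), so NO divisor set `X ⊇ A(c)` has `gr^W_6 = 0`; and of the `5040` vectors of the orbit `G·c`
exactly five converge — `c, (4,0,2,2,0,1,4,-1), (0,2,2,0,4,4,1,4), (1,0,4,0,4,2,0,4), (4,0,4,0,1,0,2,2)` — each with the
same obstruction.  So at `c` neither Brown's weight bound [Brown2016, Cor. 8.2] (for any admissible divisor model of any
convergent symmetry image) nor the symmetry (27) detects the absence of `ζ(3)`, which (4)+(17) prove.
-/

namespace Summit.KontsevichZagierPeriods.Zeta5Search.Families.Cellular

open Literature.NumberTheory.Irrationality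
open Literature.NumberTheory.Irrationality.BrownZudilin2022
open Literature.NumberTheory.Transcendental (zetaValue)

/-! ### The integer binomial `zchoose` -/

/-- `zchoose n k > 0` when `0 ≤ k ≤ n`. -/
theorem zchoose_pos {n k : ℤ} (h0 : 0 ≤ k) (h1 : k ≤ n) : 0 < zchoose n k := by
  unfold zchoose
  rw [if_pos ⟨h0, h1⟩]
  exact_mod_cast Nat.choose_pos (Int.toNat_le_toNat h1)

/-! ### `Q(a) = 0` off the live cone -/

/-- **Off the live cone BZ's leading coefficient vanishes**: every term of the double sum (17) has a zero binomial factor.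
systematic search; no irrationality claim unless certified. -/
theorem QOf_eq_zero_of_not_liveBZ (a : Fin 8 → ℤ) (hc : Converges a) (hl : ¬ LiveBZ a) : QOf a = 0 := by
  rw [converges_iff] at hc
  rw [XStarCover.liveBZ_iff] at hl
  simp only [not_and_or, not_le] at hl
  unfold QOf Qcoeff
  refine mul_eq_zero_of_right _ (Finset.sum_eq_zero fun k₁ hk₁ => Finset.sum_eq_zero fun k₂ hk₂ => ?_)
  simp only [Finset.mem_Icc, pOf, qOf, Matrix.cons_val] at hk₁ hk₂ ⊢
  simp only [zchoose]
  split_ifs <;> first | (simp; done) | (exfalso; omega)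

/-! ### `Q(a) ≠ 0` on the live cone -/

/-- Every term of (17) is non-negative. -/
theorem Qterm_nonneg (p : Fin 7 → ℤ) (q : Fin 5 → ℤ) (k₁ k₂ : ℤ) :
    0 ≤ zchoose k₁ (p 0) * zchoose k₂ (p 6) * zchoose (k₁ + k₂ + q 2 - p 0 - p 6) (p 3 + q 2 - p 0 - p 6)
        * zchoose (q 0) (k₁ - p 1) * zchoose (q 1) (k₁ - p 2) * zchoose (q 3) (k₂ - p 4) * zchoose (q 4) (k₂ - p 5) := by
  have h := BinomialSum.zchoose_nonneg
  exact mul_nonneg (mul_nonneg (mul_nonneg (mul_nonneg (mul_nonneg (mul_nonneg (h _ _) (h _ _)) (h _ _)) (h _ _))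
    (h _ _)) (h _ _)) (h _ _)

/-- **On the live cone BZ's leading coefficient is non-zero**: the term `k₁ = min (pOf a 1 + qOf a 0) (pOf a 2 + qOf a 1)`,
`k₂ = min (pOf a 4 + qOf a 3) (pOf a 5 + qOf a 4)` of (17) (BZ's `k₁ = min(p₁+q₁, p₂+q₂)`, `k₂ = min(p₄+q₄, p₅+q₅)`) has seven
positive factors and all terms are `≥ 0`; in particular `sign Q(a) = (-1)^{Σ pᵢ(a)}` there.
systematic search; no irrationality claim unless certified. -/
theorem QOf_ne_zero_of_liveBZ (a : Fin 8 → ℤ) (hc : Converges a) (hl : LiveBZ a) : QOf a ≠ 0 := by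
  rw [converges_iff] at hc
  rw [XStarCover.liveBZ_iff] at hl
  unfold QOf Qcoeff
  refine mul_ne_zero (pow_ne_zero _ (by norm_num)) (ne_of_gt ?_)
  refine Finset.sum_pos' (fun k₁ _ => Finset.sum_nonneg fun k₂ _ => Qterm_nonneg _ _ _ _)
    ⟨min (pOf a 1 + qOf a 0) (pOf a 2 + qOf a 1), ?_, ?_⟩
  · simp only [Finset.mem_Icc, pOf, qOf, Matrix.cons_val]
    omega
  · refine Finset.sum_pos' (fun k₂ _ => Qterm_nonneg _ _ _ _)
      ⟨min (pOf a 4 + qOf a 3) (pOf a 5 + qOf a 4), ?_, ?_⟩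
    · simp only [Finset.mem_Icc, pOf, qOf, Matrix.cons_val]
      omega
    · simp only [pOf, qOf, Matrix.cons_val]
      refine mul_pos (mul_pos (mul_pos (mul_pos (mul_pos (mul_pos ?_ ?_) ?_) ?_) ?_) ?_) ?_ <;>
        (apply zchoose_pos <;> omega)

/-- **The live cone is where BZ's leading coefficient lives**: for convergent `a`, `LiveBZ a ↔ Q(a) ≠ 0`.
systematic search; no irrationality claim unless certified. -/
theorem liveBZ_iff_QOf_ne_zero (a : Fin 8 → ℤ) (hc : Converges a) : LiveBZ a ↔ QOf a ≠ 0 :=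
  ⟨QOf_ne_zero_of_liveBZ a hc, fun h => by_contra fun hl => h (QOf_eq_zero_of_not_liveBZ a hc hl)⟩

/-- **Off the live cone the cellular integral lies in `ℚζ(2) + ℚ`**, given BZ's decomposition (4) (named Literature fact,
used as a hypothesis): `I(a) = -4P̂·ζ(2) - 2P`.  No irrationality content.
systematic search; no irrationality claim unless certified. -/
theorem mem_QZeta2_of_not_liveBZ (hdec : decomposition) (a : Fin 8 → ℤ) (hc : Converges a) (hl : ¬ LiveBZ a) :
    ∃ r s : ℚ, cellularIntegral a = r * zetaValue 2 + s := by
  obtain ⟨Phat, P, h⟩ := hdec a hc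
  refine ⟨-4 * Phat, -2 * P, ?_⟩
  rw [h, QOf_eq_zero_of_not_liveBZ a hc hl]
  push_cast
  ring

/-- **The whole convergent cone, given (4)**: `I(a) ∈ ℚ·(2ζ(5)+4ζ(3)ζ(2)) + ℚζ(2) + ℚ`, the first coefficient being
non-zero iff `a` is live.  (The membership is (4) itself; the content is the `iff`.)
systematic search; no irrationality claim unless certified. -/
theorem decomposition_live_iff (hdec : decomposition) (a : Fin 8 → ℤ) (hc : Converges a) :
    ∃ q r s : ℚ, cellularIntegral a = q * (2 * zetaValue 5 + 4 * zetaValue 3 * zetaValue 2) + r * zetaValue 2 + s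
      ∧ (q ≠ 0 ↔ LiveBZ a) := by
  obtain ⟨Phat, P, h⟩ := hdec a hc
  refine ⟨(QOf a : ℚ), -4 * Phat, -2 * P, ?_, ?_⟩
  · rw [h]
    push_cast
    ring
  · rw [liveBZ_iff_QOf_ne_zero a hc]
    exact_mod_cast Iff.rfl

/-! ### The specimen `c = (2,0,4,0,2,1,1,4)` -/

/-- The specimen exponent vector `c = (2,0,4,0,2,1,1,4)` (fam-brown8 g11). -/
def specimenC : Fin 8 → ℤ := ![2, 0, 4, 0, 2, 1, 1, 4]

/-- `c` satisfies the seventeen convergence conditions (3). -/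
theorem specimenC_converges : Converges specimenC := by decide

/-- `c` is NOT live: the valuations `v_{123457}(c)` and `v_{17}(c)` vanish. -/
theorem specimenC_not_liveBZ : ¬ LiveBZ specimenC := by decide

/-- `c` is NOT in the `X*`-region of the gen-3 certificate. -/
theorem specimenC_not_polarWithinXStar : ¬ PolarWithinXStar specimenC := by decide

/-- `p₀(c) = a₅+a₆-a₈ = -1 < 0`: the first binomial of every term of (17) vanishes. -/
theorem pOf_specimenC_zero : pOf specimenC 0 = -1 := by decide

/-- `Q(c) = 0` (by evaluation; also an instance of `QOf_eq_zero_of_not_liveBZ`). -/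
theorem QOf_specimenC : QOf specimenC = 0 := by decide

/-- At `c` the cellular integral lies in `ℚζ(2) + ℚ` (given (4)). -/
theorem specimenC_mem_QZeta2_of (hdec : decomposition) :
    ∃ r s : ℚ, cellularIntegral specimenC = r * zetaValue 2 + s :=
  mem_QZeta2_of_not_liveBZ hdec specimenC specimenC_converges specimenC_not_liveBZ

end Summit.KontsevichZagierPeriods.Zeta5Search.Families.Cellular
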